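import Summits.CriticalPhenomena.PercolationContinuityZ3.Theorems.PercNearOneGluingNoHeavyLowerTailStarSetForestComonotone
import Summits.CriticalPhenomena.PercolationContinuityZ3.Theorems.PercNearOneGluingNoHeavyLowerTailStarSetStateExpansion
import Summits.CriticalPhenomena.PercolationContinuityZ3.Theorems.PercNearOneGluingNoHeavyLowerTailStarSetLevelTwo
import HarnessLib

/-!
# `NoHeavyLowerTail` (stmt-CriticalPhenomena-4575) — OES at level `j ≤ 2` for two-port pendant stars whose port graph is a FOREST

Support file (prover `prim-gen-swap` gen 7; `--supports stmt-CriticalPhenomena-4575`).  No definitions, no named facts, no sorries.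

**Theorem (`StarSet.setCS_twoPortStarForest_levelTwo`).**  As `StarSet.setCS_twoPortStars_levelTwo` (…StarSetLevelTwo), but the `2m` ports
need not be distinct: the stars are indexed in a LEAF-PEELING order of their port graph, `k < i → p' k ∉ {p i, p' i}` (the second port of an
earlier star is never a port of a later one; seat memo R3-SEATS.md §9 — this excludes parallel stars and cycles and is automatic for distinct
ports).  Conclusion: `CS_w(S, c)` for `S = {s i}`, `c ∈ A` off the ports dominating them, every `|A|`, every `m`.
Proof: state expansion (`StarSet.setCSdiff_state_expansion`) + extreme regrouping (`StarSet.extreme_regroup`) + glued words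
(`StarSet.gluedWord_nonneg`, no distinctness needed) + the comonotone word via the forest certificate (`StarSet.comonotone_word_nonneg_forest`).
-/

noncomputable section

namespace Summit.CriticalPhenomena.PercolationContinuityZ3.Theorems

open MeasureTheory Set Literature.Probability.LatticeModels Literature.Probability.Percolation
open scoped Classical BigOperators

variable {n m : ℕ}

namespace StarSet

/-- **The comonotone word is nonnegative** (cell port sets `Y(σ) = P_σ`; restatement of `StarSet.comonotone_word_nonneg_forest` for any
description of the port sets by membership). [folklore] -/
theorem comonotoneWord_nonneg_forest (w : Sym2 (Fin n) → unitInterval) (A : Finset (Fin n)) (s p p' : Fin m → Fin n) (c : Fin n)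
    (j : ℕ) (hj : j ≤ 2) (hs : Function.Injective s) (hsA : ∀ i, s i ∉ A) (hpA : ∀ i, p i ∈ A) (hp'A : ∀ i, p' i ∈ A)
    (hpp' : ∀ i, p i ≠ p' i) (hforest : ∀ k i, k < i → p' k ≠ p i ∧ p' k ≠ p' i) (hcA : c ∈ A)
    (hcp : ∀ i, c ≠ p i ∧ c ≠ p' i) (hwjunk : ∀ i u, u ≠ s i → u ≠ p i → u ≠ p' i → w s(s i, u) = 0)
    (hdom : ∀ i, (prodBernoulli w).real {ω : BondConfig (Fin n) | (A.filter fun z => ω ∈ openConn (p i) z).card ≤ j} ≤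
      (prodBernoulli w).real {ω : BondConfig (Fin n) | (A.filter fun z => ω ∈ openConn c z).card ≤ j})
    (Y : Finset (Fin m) → Finset (Fin n)) (hY : ∀ σ, Y σ = σ.image p ∪ σ.image p') :
    0 ≤ ∑ σ ∈ (Finset.univ : Finset (Fin m)).powerset,
      ((∏ i ∈ σ, ((w s(s i, p i) : ℝ) * w s(s i, p' i))) *
          ∏ i ∈ Finset.univ \ σ, (1 - (w s(s i, p i) : ℝ) * w s(s i, p' i))) *
        ((prodBernoulli w).real {ω : BondConfig (Fin n) |
            (∀ u ∈ Y σ, ¬ (openGraph (ω ∩ {e | ∀ v ∈ Finset.univ.image s, v ∉ e})).Reachable c u) ∧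
            (A.filter fun z => (openGraph (ω ∩ {e | ∀ v ∈ Finset.univ.image s, v ∉ e})).Reachable c z).card ≤ j} -
          (prodBernoulli w).real {ω : BondConfig (Fin n) |
            (∀ u ∈ Y σ, ¬ (openGraph (ω ∩ {e | ∀ v ∈ Finset.univ.image s, v ∉ e})).Reachable c u) ∧
            1 ≤ (A.filter fun z => ∃ u ∈ Y σ, (openGraph (ω ∩ {e | ∀ v ∈ Finset.univ.image s, v ∉ e})).Reachable u z).card ∧
            (A.filter fun z => ∃ u ∈ Y σ,
              (openGraph (ω ∩ {e | ∀ v ∈ Finset.univ.image s, v ∉ e})).Reachable u z).card ≤ j}) := by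
  have h := comonotone_word_nonneg_forest w A s p p' c j hj hs hsA hpA hp'A hpp' hforest hcA hcp hwjunk hdom
  refine le_trans h (le_of_eq (Finset.sum_congr rfl fun σ _ => ?_))
  rw [hY σ]

/-- **OES at level `j ≤ 2` for two-port pendant stars whose port graph is a FOREST (any number of stars).**  Stars `s i ∉ A`
(pairwise distinct), ports `p i ≠ p' i ∈ A`, indexed in a leaf-peeling order (`k < i → p' k ∉ {p i, p' i}`); `c ∈ A` off the ports,
dominating every port.  Then `μ(c ↮ S, 1 ≤ |π(S)| ≤ j) ≤ μ(c ↮ S, |π(c)| ≤ j)` for `S = {s i : i < m}`.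
[cite: VandenbergHaggstromKahn2005, Thm. 1.5 (p. 7) — the only non-elementary input, via `observerSet_le_of_lonelier`] -/
theorem setCS_twoPortStarForest_levelTwo (w : Sym2 (Fin n) → unitInterval) (A : Finset (Fin n)) (s p p' : Fin m → Fin n)
    (c : Fin n) (j : ℕ) (hj : j ≤ 2) (hs : Function.Injective s) (hsA : ∀ i, s i ∉ A) (hpA : ∀ i, p i ∈ A)
    (hp'A : ∀ i, p' i ∈ A) (hpp' : ∀ i, p i ≠ p' i) (hforest : ∀ k i, k < i → p' k ≠ p i ∧ p' k ≠ p' i)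
    (hcA : c ∈ A) (hcp : ∀ i, c ≠ p i ∧ c ≠ p' i)
    (hobs : ∀ i u, u ≠ s i → u ≠ p i → u ≠ p' i → w s(s i, u) = 0)
    (hdom : ∀ i,
      (prodBernoulli w).real {ω : BondConfig (Fin n) | (A.filter fun z => ω ∈ openConn (p i) z).card ≤ j} ≤
          (prodBernoulli w).real {ω : BondConfig (Fin n) | (A.filter fun z => ω ∈ openConn c z).card ≤ j} ∧
        (prodBernoulli w).real {ω : BondConfig (Fin n) | (A.filter fun z => ω ∈ openConn (p' i) z).card ≤ j} ≤
          (prodBernoulli w).real {ω : BondConfig (Fin n) | (A.filter fun z => ω ∈ openConn c z).card ≤ j}) :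
    (prodBernoulli w).real {ω : BondConfig (Fin n) | (∀ x ∈ Finset.univ.image s, ω ∉ openConn c x) ∧
        1 ≤ (A.filter fun z => ∃ x ∈ Finset.univ.image s, ω ∈ openConn x z).card ∧
        (A.filter fun z => ∃ x ∈ Finset.univ.image s, ω ∈ openConn x z).card ≤ j} ≤
      (prodBernoulli w).real {ω : BondConfig (Fin n) | (∀ x ∈ Finset.univ.image s, ω ∉ openConn c x) ∧
        (A.filter fun z => ω ∈ openConn c z).card ≤ j} := by
  have hps : ∀ i k, p i ≠ s k := fun i k h => hsA k (h ▸ hpA i)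
  have hp's : ∀ i k, p' i ≠ s k := fun i k h => hsA k (h ▸ hp'A i)
  have hcs : ∀ i, c ≠ s i := fun i h => hsA i (h ▸ hcA)
  rw [← sub_nonneg, setCSdiff_state_expansion w A s p p' c j hs hsA hps hp's hpp' hcs hobs]
  have hre := extreme_regroup (fun i => (w s(s i, p i) : ℝ)) (fun i => (w s(s i, p' i) : ℝ)) (fun i => (w _).2.1)
    (fun i => (w _).2.2) (fun i => (w _).2.1) (fun i => (w _).2.2)
    (fun t => (prodBernoulli w).real {ω : BondConfig (Fin n) |
        (∀ u ∈ (Finset.univ.filter fun i => (t i).1 = true).image p ∪ (Finset.univ.filter fun i => (t i).2 = true).image p',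
          ¬ (openGraph (ω ∩ {e | ∀ v ∈ Finset.univ.image s, v ∉ e})).Reachable c u) ∧
        (A.filter fun z => (openGraph (ω ∩ {e | ∀ v ∈ Finset.univ.image s, v ∉ e})).Reachable c z).card ≤ j} -
      (prodBernoulli w).real {ω : BondConfig (Fin n) |
        (∀ u ∈ (Finset.univ.filter fun i => (t i).1 = true).image p ∪ (Finset.univ.filter fun i => (t i).2 = true).image p',
          ¬ (openGraph (ω ∩ {e | ∀ v ∈ Finset.univ.image s, v ∉ e})).Reachable c u) ∧
        1 ≤ (A.filter fun z => ∃ u ∈ (Finset.univ.filter fun i => (t i).1 = true).image p ∪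
            (Finset.univ.filter fun i => (t i).2 = true).image p',
          (openGraph (ω ∩ {e | ∀ v ∈ Finset.univ.image s, v ∉ e})).Reachable u z).card ∧
        (A.filter fun z => ∃ u ∈ (Finset.univ.filter fun i => (t i).1 = true).image p ∪
            (Finset.univ.filter fun i => (t i).2 = true).image p',
          (openGraph (ω ∩ {e | ∀ v ∈ Finset.univ.image s, v ∉ e})).Reachable u z).card ≤ j})
  beta_reduce at hre
  rw [hre]
  refine Finset.sum_nonneg fun e _ => mul_nonneg (Finset.prod_nonneg fun i _ =>
    extremeCoeff_nonneg _ _ (w _).2.1 (w _).2.2 (w _).2.1 (w _).2.2 (e i)) ?_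
  by_cases he : ∀ i, e i = 0
  · refine comonotoneWord_nonneg_forest w A s p p' c j hj hs hsA hpA hp'A hpp' hforest hcA hcp hobs (fun i => (hdom i).1) _ ?_
    intro σ
    ext u
    simp only [he, Finset.mem_union, Finset.mem_image, Finset.mem_filter, Finset.mem_univ, true_and]
    constructor
    · rintro (⟨i, hi, rfl⟩ | ⟨i, hi, rfl⟩)
      · by_cases hiσ : i ∈ σ
        · exact Or.inl ⟨i, hiσ, rfl⟩
        · simp [hiσ] at hi
      · by_cases hiσ : i ∈ σ
        · exact Or.inr ⟨i, hiσ, rfl⟩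
        · simp [hiσ] at hi
    · rintro (⟨i, hi, rfl⟩ | ⟨i, hi, rfl⟩)
      · exact Or.inl ⟨i, by simp [hi], rfl⟩
      · exact Or.inr ⟨i, by simp [hi], rfl⟩
  · push Not at he
    obtain ⟨i₀, hi₀⟩ := he
    refine gluedWord_nonneg w A s p p' c j hj hs hsA hpA hp'A hpp' hcA hcp hobs hdom e i₀ hi₀ _ ?_
    intro σ u
    simp only [Finset.mem_union, Finset.mem_image, Finset.mem_filter, Finset.mem_univ, true_and]
    constructor
    · rintro (⟨i, hi, rfl⟩ | ⟨i, hi, rfl⟩)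
      · by_cases hiσ : i ∈ σ
        · exact Or.inr (Or.inl ⟨i, hiσ, rfl⟩)
        · simp only [hiσ, if_false, decide_eq_true_eq] at hi
          exact Or.inl (Or.inl ⟨i, hi, rfl⟩)
      · by_cases hiσ : i ∈ σ
        · exact Or.inr (Or.inr ⟨i, hiσ, rfl⟩)
        · simp only [hiσ, if_false, decide_eq_true_eq] at hi
          exact Or.inl (Or.inr ⟨i, hi, rfl⟩)
    · rintro ((⟨i, hi, rfl⟩ | ⟨i, hi, rfl⟩) | (⟨i, hi, rfl⟩ | ⟨i, hi, rfl⟩))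
      · refine Or.inl ⟨i, ?_, rfl⟩
        by_cases hiσ : i ∈ σ
        · simp [hiσ]
        · simp [hiσ, hi]
      · refine Or.inr ⟨i, ?_, rfl⟩
        by_cases hiσ : i ∈ σ
        · simp [hiσ]
        · simp [hiσ, hi]
      · exact Or.inl ⟨i, by simp [hi], rfl⟩
      · exact Or.inr ⟨i, by simp [hi], rfl⟩

end StarSet

end Summit.CriticalPhenomena.PercolationContinuityZ3.Theorems

end
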